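import Literature.NumberTheory.EllipticCurves.EichlerShimuraPeriodsRankProofs
import Literature.NumberTheory.EllipticCurves.ModularDegreeFormulaDomainProofs
import Literature.NumberTheory.EllipticCurves.HaberlandStokesProofs
import Literature.NumberTheory.EllipticCurves.PeterssonFdCoordinatesProofs
import HarnessLib

/-!
# Haberland's formula, boundary step: `2(2i)ⁿ⁺¹ (g, f) = ∑_A ⟨ρ_f(A), \overline{H_{ρ²}(A) - H_ρ(A)}⟩`

Theorems only (no definitions, no named facts). Third analytic brick of the proof of **Haberland's
formula** for cusp forms on `Γ₀(N)` (V. Paşol, A. A. Popa, *Modular forms and period polynomials*,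
Proc. LMS 107 (2013), Thm. 3.2; we follow the proof of Thm. 8.6 in §8.2 on the standard fundamental
domain `𝔉`, specialised to cusp forms, `a_A = 0`). After Stokes' theorem
(`HaberlandStokes.stokes_fd`: `(2i)ⁿ⁺¹∫_𝔉 yⁿ f_A ḡ_A dx dy = ∮_{∂𝔉} F_A ḡ_A dz̄`,
`F_A(z) = ∫_z^{i∞} f_A(t)(t - z̄)ⁿ dt`) and the Petersson product in coordinates
(`peterssonProduct_eq_intervalIntegral`) this file carries out the boundary manipulations of
PP §8.2 and arrives at PP's formula (7.11)/(8.11) for cusp forms: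

* `HaberlandBoundary.eichlerKernel_T_smul`, `integrand_left_eq_right`, `sum_left_eq_sum_right` —
  "since `F_{AT}(z) = F_A(Tz)`, the integrals over the vertical sides of `𝔉` cancel" (after summing
  over the cosets, re-indexed by `q ↦ T⁻¹q`: `exists_rep_inv_smul`, `slash_rep_inv_smul`,
  `sum_smul_eq`);
* `HaberlandBoundary.eichlerKernel_S_smul` — the `S`-transformation
  `F_A(Sτ) τ̄ⁿ = F_{AS}(τ) - ρ_f(AS)(τ̄)` ("`F̃_A(z) - F̃_{AS⁻¹}|S(z) = ρ_f(A)(z̄)`"), with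
  `ρ_f(B)(X) = ∫₀^{i∞} f_B(t)(t - X)ⁿ dt` the period polynomial, in the tree the `momPoly` of the
  M-symbol moments `msymbMoment n B · f` (from the cocycle identities `periodFn_eq`,
  `momPoly_msymbMoment`); `S_smul_arc`: `S` acts on the bottom arc `ζ(x) = x + i√(1-x²)` as
  `x ↦ -x`; `arc_integrand_neg`, `intervalIntegral_arc_eq`, `two_mul_sum_arc` — "we change
  variables `z → Sz`, which reverses the order of integration", whence
  `2 ∑_A ∫_{arc} F_A ḡ_A dz̄ = ∑_A ∫_{arc} ρ_f(A)(z̄) ḡ_A(z) dz̄`;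
* `HaberlandBoundary.intervalIntegral_momPoly_arc` — "(3.3)": the arc integral as the pairing
  `⟨ρ_f(A), \overline{H_{ρ²}(A) - H_ρ(A)}⟩` (`invForm` of `EichlerShimuraRealInjectivityProofs`;
  `H_{z₀}(A) = ∫_{z₀}^{i∞} g_A(t)(t - X)ⁿ dt` is `momVec n (g∣A) z₀`; the arc integral of `tᵐ g_A`
  is a difference of the primitives `powPrimitive` by the fundamental theorem of calculus,
  `intervalIntegral_arc_pow_mul`);
* **`HaberlandBoundary.two_mul_petersson_eq_sum_invForm`** — for even `n`, cusp forms
  `f, g ∈ S_{n+2}(Γ₀(N))` and a system `g_q` of coset representatives,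
  `2 (2i)ⁿ⁺¹ · peterssonProduct Γ₀(N) (n+2) g f
     = ∑_q invForm (μ_f(g_q⁻¹)) (\overline{momVec (g∣g_q⁻¹) ρ² - momVec (g∣g_q⁻¹) ρ})`
  (`ρ = ½ + i√3/2`, `ρ² = -½ + i√3/2`), i.e. PP (7.11) with `a_A = 0`:
  `C_k C_Γ (f,g) = ½ ∑_A ⟨ρ_f(A), H̄_ρ(A) - H̄_{ρ²}(A)⟩`, `C_k = -(2i)^{k-1}` (the tree's
  `peterssonProduct` is antilinear in the first variable and equals `C_Γ (f, g)_{PP}`).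

The remaining algebra of §8.2 (`H_{ρ²} = H_ρ|T`, `ρ_g = H_ρ|(1-TS)`, the period relations and the
`Γ₁`-invariance of the pairing, giving `6C_k(f,g) = ⟨ρ_f|(T-T⁻¹), ρ̄_g⟩`) is the next brick.

## References

* [PasolPopa2013] V. Paşol, A. A. Popa, Proc. LMS 107 (2013) 713–743, arXiv:1202.5802: Thm. 3.2,
  (3.3), §8.2 (proof of Thm. 8.6, (7.11), (8.12)), (2.10).
-/

noncomputable section

open MeasureTheory Set Filter Topology Complex
open scoped ComplexConjugate UpperHalfPlane MatrixGroups ModularForm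

namespace Literature.NumberTheory.EllipticCurves.ModularForms

namespace HaberlandBoundary

open UpperHalfPlane hiding I
open ModularGroup CongruenceSubgroup

variable {N : ℕ} [NeZero N] {n : ℕ}

/-! ### Slashing by `S` and `T`: values and kernels -/

/-- `φ(S τ) = (φ ∣ S)(τ) τᵏ`. [folklore] -/
theorem apply_S_smul (k : ℤ) (φ : ℍ → ℂ) (τ : ℍ) :
    φ (S • τ) = (φ ∣[k] S) τ * (τ : ℂ) ^ k := by
  rw [ModularForm.SL_slash_apply, denom_S]
  have hτ : (τ : ℂ) ≠ 0 := ne_zero τ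
  rw [mul_assoc, ← zpow_add₀ hτ, neg_add_cancel, zpow_zero, mul_one]

/-- `φ(T τ) = (φ ∣ T)(τ)`. [folklore] -/
theorem apply_T_smul (k : ℤ) (φ : ℍ → ℂ) (τ : ℍ) :
    φ (T • τ) = (φ ∣[k] T) τ := by
  rw [ModularForm.SL_slash_apply, denom_apply]
  simp [coe_T]

/-- `(icmat S) (c, 1) = (-1, c)`. [folklore] -/
theorem icmat_S_mulVec_pair (c : ℂ) : (icmat S).mulVec ![c, 1] = ![-1, c] := by
  funext i
  fin_cases i <;> simp [coe_S]

/-- `![p 1, -p 0] = -(icmat S) p`. [folklore] -/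
theorem vec_swap_eq_neg_icmat_S (p : Fin 2 → ℂ) : ![p 1, -p 0] = -(icmat S).mulVec p := by
  funext i
  fin_cases i <;> simp [coe_S]

/-- `icmat (-γ) = -icmat γ`. [folklore] -/
theorem icmat_neg (γ : SL(2, ℤ)) : icmat (-γ) = -icmat γ := by
  ext i j
  simp [icmat]

/-- For even `n`: `c_f(-γ)(-q) = c_f(γ)(q)`. [folklore] -/
theorem periodFn_neg_neg (hn : Even n) (f : CuspForm (Gamma0 N) (n + 2)) (γ : SL(2, ℤ))
    (q : Fin 2 → ℂ) : periodFn n f (-γ) (-q) = periodFn n f γ q := by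
  rw [periodFn_eq f (-γ) (-q) UpperHalfPlane.I, periodFn_eq f γ q UpperHalfPlane.I,
    slash_neg_eq_of_even n hn, SL_neg_smul, icmat_neg, Matrix.neg_mulVec, Matrix.mulVec_neg, neg_neg,
    show -q = (-1 : ℂ) • q by simp, eichlerKernel_smul_arg, hn.neg_one_pow, one_mul]

/-- The conjugate of `S τ = -1/τ` is `-1/τ̄`, so `(\overline{Sτ}, 1) = τ̄⁻¹ • (-1, τ̄)`. [folklore] -/
theorem pair_conj_S_smul (τ : ℍ) :
    (![conj (((S • τ : ℍ)) : ℂ), 1] : Fin 2 → ℂ) = (conj (τ : ℂ))⁻¹ • ![-1, conj (τ : ℂ)] := by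
  have hτ : conj (τ : ℂ) ≠ 0 := by
    rw [map_ne_zero]; exact ne_zero τ
  rw [modular_S_smul, coe_mk]
  funext i
  fin_cases i
  · simp [map_neg, map_inv₀]
  · simp [hτ]

/-- **The `S`-transformation of the Eichler integral `F_A(z) = ∫_z^{i∞} f_A(t)(t - z̄)ⁿ dt`**
(Paşol–Popa, proof of Thm. 3.2 / §8.2, "as in the proof of Prop. (pa1),
`F̃_A(z) - F̃_{AS⁻¹}|S(z) = ρ_f(A)(z̄)`"): for even `n`,
`F_A(Sτ) τ̄ⁿ = F_{AS}(τ) - ρ_f(AS)(τ̄)`, where `ρ_f(B)(X) = ∫₀^{i∞} f_B(t)(t - X)ⁿ dt` is the period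
polynomial, here `momPoly` of the M-symbol moments `msymbMoment n B · f`. [cite: PasolPopa2013, §8.2 (proof of Thm. 8.6) and (2.10)] -/
theorem eichlerKernel_S_smul (hn : Even n) (f : CuspForm (Gamma0 N) (n + 2)) (A : SL(2, ℤ)) (τ : ℍ) :
    eichlerKernel n (⇑f ∣[(n + 2 : ℤ)] A) (S • τ) ![conj (((S • τ : ℍ)) : ℂ), 1] * (conj (τ : ℂ)) ^ n =
      eichlerKernel n (⇑f ∣[(n + 2 : ℤ)] (A * S)) τ ![conj (τ : ℂ), 1] -
        momPoly n (fun j ↦ msymbMoment n (A * S) j f) ![conj (τ : ℂ), 1] := by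
  set p : Fin 2 → ℂ := ![conj (τ : ℂ), 1] with hp
  have hτ : conj (τ : ℂ) ≠ 0 := by
    rw [map_ne_zero]; exact ne_zero τ
  -- the transformation law at `S`, as a difference of period cocycles
  have h1 := periodFn_eq f (A * S) p τ
  have h2 := periodFn_eq f A ((icmat S).mulVec p) (S • τ)
  have hdagger : eichlerKernel n (⇑f ∣[(n + 2 : ℤ)] (A * S)) τ p -
      eichlerKernel n (⇑f ∣[(n + 2 : ℤ)] A) (S • τ) ((icmat S).mulVec p) =
        momPoly n (fun j ↦ msymbMoment n (A * S) j f) p := by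
    rw [momPoly_msymbMoment, vec_swap_eq_neg_icmat_S, show A * S * S = -A by
      rw [mul_assoc, S_mul_S_eq_neg_one, mul_neg_one], periodFn_neg_neg hn, h1, h2, mul_smul,
      icmat_mul, ← Matrix.mulVec_mulVec]
    ring
  -- `(\overline{Sτ}, 1) = τ̄⁻¹ • S(τ̄, 1)` and homogeneity
  have hvec : (![conj (((S • τ : ℍ)) : ℂ), 1] : Fin 2 → ℂ) = (conj (τ : ℂ))⁻¹ • (icmat S).mulVec p := by
    rw [pair_conj_S_smul, hp, icmat_S_mulVec_pair]
  rw [hvec, eichlerKernel_smul_arg, ← hdagger, inv_pow, mul_comm, ← mul_assoc,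
    mul_inv_cancel₀ (pow_ne_zero _ hτ), one_mul]
  ring

/-- `(f ∣ A) ∣ γ = f ∣ (A γ)` for `SL(2, ℤ)` elements, the second slash taken in `GL(2, ℝ)`. [folklore] -/
theorem slash_slash_coe (k : ℤ) (φ : ℍ → ℂ) (A γ : SL(2, ℤ)) :
    (φ ∣[k] A) ∣[k] (γ : GL (Fin 2) ℝ) = φ ∣[k] (A * γ) := by
  rw [← ModularForm.SL_slash, ← SlashAction.slash_mul]

/-- **The `T`-transformation of the Eichler integral**: `F_{AT}(τ) = F_A(Tτ)`
(Paşol–Popa §8.2: "Since `F_{AT}(z) = F_A(Tz)`, the integrals over the vertical sides of `𝔉`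
cancel"). [cite: PasolPopa2013, §8.2 (proof of Thm. 8.6)] -/
theorem eichlerKernel_T_smul (f : CuspForm (Gamma0 N) (n + 2)) (A : SL(2, ℤ)) (τ : ℍ) :
    eichlerKernel n (⇑f ∣[(n + 2 : ℤ)] (A * T)) τ ![conj (τ : ℂ), 1] =
      eichlerKernel n (⇑f ∣[(n + 2 : ℤ)] A) (T • τ) ![conj (((T • τ : ℍ)) : ℂ), 1] := by
  have hφ : IsCuspFunction N (⇑f ∣[(n + 2 : ℤ)] A) := isCuspFunction_slash f A
  have hψ : IsCuspFunction N ((⇑f ∣[(n + 2 : ℤ)] A) ∣[(n + 2 : ℤ)] (T : GL (Fin 2) ℝ)) := by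
    rw [slash_slash_coe]; exact isCuspFunction_slash f (A * T)
  have hT : ((T : GL (Fin 2) ℝ) : Matrix (Fin 2) (Fin 2) ℝ) 1 0 = 0 := by
    simp [coe_T]
  have h := hφ.eichlerKernel_slash_eq_of_apply_one_zero (n := n) (det_coe_pos T) hT hψ
    ![conj (τ : ℂ), 1] τ
  rw [slash_slash_coe] at h
  rw [h, cmat_coe]
  congr 1
  rw [modular_T_smul, coe_vadd]
  funext i
  fin_cases i
  · simp [coe_T, Matrix.mulVec, dotProduct, add_comm]
  · simp [coe_T, Matrix.mulVec, dotProduct]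

/-- `(g ∣ A)(T τ) = (g ∣ AT)(τ)`. [folklore] -/
theorem slash_apply_T_smul (k : ℤ) (φ : ℍ → ℂ) (A : SL(2, ℤ)) (τ : ℍ) :
    (φ ∣[k] A) (T • τ) = (φ ∣[k] (A * T)) τ := by
  rw [show (φ ∣[k] A) (T • τ) = ((φ ∣[k] A) ∣[k] T) τ from apply_T_smul k _ τ, ← SlashAction.slash_mul]

/-- `(g ∣ A)(S τ) = (g ∣ AS)(τ) τᵏ`. [folklore] -/
theorem slash_apply_S_smul (k : ℤ) (φ : ℍ → ℂ) (A : SL(2, ℤ)) (τ : ℍ) :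
    (φ ∣[k] A) (S • τ) = (φ ∣[k] (A * S)) τ * (τ : ℂ) ^ k := by
  rw [show (φ ∣[k] A) (S • τ) = ((φ ∣[k] A) ∣[k] S) τ * (τ : ℂ) ^ k from apply_S_smul k _ τ,
    ← SlashAction.slash_mul]

/-! ### The bottom arc `x ↦ x + i√(1 - x²)` of the fundamental domain -/

/-- Positivity of `1 - x²` on `[-1/2, 1/2]`. [folklore] -/
theorem one_sub_sq_pos {x : ℝ} (hx : x ∈ Icc (-(1 / 2) : ℝ) (1 / 2)) : 0 < 1 - x ^ 2 := by
  have h : |x| ≤ 1 / 2 := abs_le.mpr ⟨by linarith [hx.1], hx.2⟩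
  have h' : |x| ^ 2 ≤ (1 / 2) ^ 2 := by gcongr
  rw [sq_abs] at h'
  linarith

/-- The arc point `x + i√(1-x²)` has positive imaginary part. [folklore] -/
theorem arc_im_pos {x : ℝ} (hx : x ∈ Icc (-(1 / 2) : ℝ) (1 / 2)) :
    0 < ((x : ℂ) + Real.sqrt (1 - x ^ 2) * I).im := by
  simpa using Real.sqrt_pos.mpr (one_sub_sq_pos hx)

/-- The arc point lies on the unit circle: `\overline{ζ} ζ = 1`. [folklore] -/
theorem conj_arc_mul_arc {x : ℝ} (hx : x ∈ Icc (-(1 / 2) : ℝ) (1 / 2)) :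
    conj ((x : ℂ) + Real.sqrt (1 - x ^ 2) * I) * ((x : ℂ) + Real.sqrt (1 - x ^ 2) * I) = 1 := by
  have hw : ((Real.sqrt (1 - x ^ 2) : ℝ) : ℂ) ^ 2 = 1 - (x : ℂ) ^ 2 := by
    rw [← Complex.ofReal_pow, Real.sq_sqrt (one_sub_sq_pos hx).le]
    push_cast
    ring
  simp only [map_add, Complex.conj_ofReal, map_mul, Complex.conj_I]
  linear_combination hw + (-(((Real.sqrt (1 - x ^ 2) : ℝ) : ℂ) ^ 2)) * Complex.I_sq

/-- **`S` acts on the arc as `x ↦ -x`**: `S(x + i√(1-x²)) = -x + i√(1-x²)`. [folklore] -/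
theorem S_smul_arc {x : ℝ} (hx : x ∈ Icc (-(1 / 2) : ℝ) (1 / 2)) :
    S • ofComplex ((x : ℂ) + Real.sqrt (1 - x ^ 2) * I) =
      ofComplex ((((-x : ℝ)) : ℂ) + Real.sqrt (1 - (-x) ^ 2) * I) := by
  have hx' : -x ∈ Icc (-(1 / 2) : ℝ) (1 / 2) := by constructor <;> linarith [hx.1, hx.2]
  apply UpperHalfPlane.ext
  rw [modular_S_smul, coe_mk, ofComplex_apply_of_im_pos (arc_im_pos hx),
    ofComplex_apply_of_im_pos (arc_im_pos hx')]
  simp only [neg_sq]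
  have h1 := conj_arc_mul_arc hx
  have hne : ((x : ℂ) + Real.sqrt (1 - x ^ 2) * I) ≠ 0 := by
    intro h0; rw [h0, mul_zero] at h1; exact zero_ne_one h1
  -- `-1/ζ = -conj ζ`
  have hinv : ((x : ℂ) + Real.sqrt (1 - x ^ 2) * I)⁻¹ = conj ((x : ℂ) + Real.sqrt (1 - x ^ 2) * I) :=
    (eq_inv_of_mul_eq_one_left h1).symm
  rw [inv_neg, hinv]
  simp only [map_add, Complex.conj_ofReal, map_mul, Complex.conj_I]
  push_cast
  ring

/-- **The `dz̄`-factor under `x ↦ -x`**: with `D(x) = 1 + i x/√(1-x²) = d\overline{ζ}/dx`,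
`D(-x) \overline{ζ(x)}² = -D(x)`. [folklore] -/
theorem D_neg_mul_conj_sq {x : ℝ} (hx : x ∈ Icc (-(1 / 2) : ℝ) (1 / 2)) :
    (1 - ((-(-x) / Real.sqrt (1 - (-x) ^ 2) : ℝ) : ℂ) * I) *
        conj ((x : ℂ) + Real.sqrt (1 - x ^ 2) * I) ^ 2 =
      -(1 - ((-x / Real.sqrt (1 - x ^ 2) : ℝ) : ℂ) * I) := by
  have hpos := one_sub_sq_pos hx
  set w : ℝ := Real.sqrt (1 - x ^ 2) with hw
  have hw0 : w ≠ 0 := (Real.sqrt_pos.mpr hpos).ne'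
  have hw2 : (w : ℂ) ^ 2 = 1 - (x : ℂ) ^ 2 := by
    rw [← Complex.ofReal_pow, hw, Real.sq_sqrt hpos.le]; push_cast; ring
  have hwC : (w : ℂ) ≠ 0 := by exact_mod_cast hw0
  rw [neg_sq, ← hw, neg_neg]
  have key : ((w : ℂ) - x * I) * ((x : ℂ) - w * I) ^ 2 = -((w : ℂ) + x * I) := by
    linear_combination (-((w : ℂ) + x * I)) * hw2 + (2 * (w : ℂ) * x ^ 2 + w ^ 3 - x * w ^ 2 * I) * Complex.I_sq
  have e1 : (1 - ((x / w : ℝ) : ℂ) * I) = ((w : ℂ) - x * I) / w := by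
    push_cast
    field_simp
  have e2 : (1 - ((-x / w : ℝ) : ℂ) * I) = ((w : ℂ) + x * I) / w := by
    push_cast
    field_simp
    ring
  have e3 : conj ((x : ℂ) + w * I) = (x : ℂ) - w * I := by
    simp only [map_add, Complex.conj_ofReal, map_mul, Complex.conj_I]
    ring
  rw [e1, e2, e3, div_mul_eq_mul_div, key, neg_div]

/-! ### The arc integrand and its `S`-symmetry -/

/-- **The arc integrand under `x ↦ -x`** (Paşol–Popa §8.2: in `∫_ρ^{ρ²} F_A ḡ_A dz̄` "we change
variables `z → Sz`, which reverses the order of integration … `F̃_A(z) - F̃_{AS⁻¹}|S(z) = ρ_f(A)(z̄)`"):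
with `ζ(x) = x + i√(1-x²)`, `D = d\overline{ζ}/dx` and
`G_A(x) = F_A(ζ(x)) \overline{g_A(ζ(x))} D(x)`, for even `n`,
`G_A(-x) = -G_{AS}(x) + ρ_f(AS)(\overline{ζ(x)}) \overline{g_{AS}(ζ(x))} D(x)`. [cite: PasolPopa2013, §8.2 (proof of Thm. 8.6)] -/
theorem arc_integrand_neg (hn : Even n) (f g : CuspForm (Gamma0 N) (n + 2)) (A : SL(2, ℤ)) {x : ℝ}
    (hx : x ∈ Icc (-(1 / 2) : ℝ) (1 / 2)) :
    eichlerKernel n (⇑f ∣[(n + 2 : ℤ)] A) (ofComplex ((((-x : ℝ)) : ℂ) + Real.sqrt (1 - (-x) ^ 2) * I))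
        ![conj ((((-x : ℝ)) : ℂ) + Real.sqrt (1 - (-x) ^ 2) * I), 1] *
      conj ((⇑g ∣[(n + 2 : ℤ)] A) (ofComplex ((((-x : ℝ)) : ℂ) + Real.sqrt (1 - (-x) ^ 2) * I))) *
      (1 - ((-(-x) / Real.sqrt (1 - (-x) ^ 2) : ℝ) : ℂ) * I) =
    -(eichlerKernel n (⇑f ∣[(n + 2 : ℤ)] (A * S)) (ofComplex ((x : ℂ) + Real.sqrt (1 - x ^ 2) * I))
          ![conj ((x : ℂ) + Real.sqrt (1 - x ^ 2) * I), 1] *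
        conj ((⇑g ∣[(n + 2 : ℤ)] (A * S)) (ofComplex ((x : ℂ) + Real.sqrt (1 - x ^ 2) * I))) *
        (1 - ((-x / Real.sqrt (1 - x ^ 2) : ℝ) : ℂ) * I)) +
      momPoly n (fun j ↦ msymbMoment n (A * S) j f) ![conj ((x : ℂ) + Real.sqrt (1 - x ^ 2) * I), 1] *
        conj ((⇑g ∣[(n + 2 : ℤ)] (A * S)) (ofComplex ((x : ℂ) + Real.sqrt (1 - x ^ 2) * I))) *
        (1 - ((-x / Real.sqrt (1 - x ^ 2) : ℝ) : ℂ) * I) := by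
  have hx' : -x ∈ Icc (-(1 / 2) : ℝ) (1 / 2) := by constructor <;> linarith [hx.1, hx.2]
  set z : ℍ := ofComplex ((x : ℂ) + Real.sqrt (1 - x ^ 2) * I) with hz
  have hzc : (z : ℂ) = (x : ℂ) + Real.sqrt (1 - x ^ 2) * I := by
    rw [hz, ofComplex_apply_of_im_pos (arc_im_pos hx)]
  have hSz : ofComplex ((((-x : ℝ)) : ℂ) + Real.sqrt (1 - (-x) ^ 2) * I) = S • z := (S_smul_arc hx).symm
  have hSzc : ((((-x : ℝ)) : ℂ) + Real.sqrt (1 - (-x) ^ 2) * I) = ((S • z : ℍ) : ℂ) := by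
    rw [← hSz, ofComplex_apply_of_im_pos (arc_im_pos hx')]
  rw [hSz, hSzc]
  -- the three laws
  have hS := eichlerKernel_S_smul hn f A z
  have hval : (⇑g ∣[(n + 2 : ℤ)] A) (S • z) = (⇑g ∣[(n + 2 : ℤ)] (A * S)) z * (z : ℂ) ^ (n + 2) := by
    rw [slash_apply_S_smul]
    norm_cast
  have hD := D_neg_mul_conj_sq hx
  rw [hzc] at hS
  rw [← hzc] at hD
  rw [hval, map_mul, map_pow, hzc]
  rw [hzc] at hD
  linear_combination (conj ((⇑g ∣[(n + 2 : ℤ)] (A * S)) z) *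
      (1 - ((-(-x) / Real.sqrt (1 - (-x) ^ 2) : ℝ) : ℂ) * I) *
      conj ((x : ℂ) + Real.sqrt (1 - x ^ 2) * I) ^ 2) * hS +
    (conj ((⇑g ∣[(n + 2 : ℤ)] (A * S)) z) *
      (eichlerKernel n (⇑f ∣[(n + 2 : ℤ)] (A * S)) z ![conj ((x : ℂ) + Real.sqrt (1 - x ^ 2) * I), 1] -
        momPoly n (fun j ↦ msymbMoment n (A * S) j f) ![conj ((x : ℂ) + Real.sqrt (1 - x ^ 2) * I), 1])) * hD

/-! ### Coset representatives: reindexing the sum over `𝒮ℒ/Γ₀(N)` by `q ↦ s⁻¹ q` -/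

section Cosets

variable (g : (↥𝒮ℒ ⧸ (Gamma0 N : Subgroup (GL (Fin 2) ℝ)).subgroupOf 𝒮ℒ) → SL(2, ℤ))
  (hg : ∀ q, (Matrix.SpecialLinearGroup.mapGL ℝ (g q) : GL (Fin 2) ℝ) = ((q.out : ↥𝒮ℒ) : GL (Fin 2) ℝ))

/-- The element of `𝒮ℒ ≤ GL(2, ℝ)` defined by `s ∈ SL(2, ℤ)`. [folklore] -/
theorem mem_SL_range (s : SL(2, ℤ)) : (Matrix.SpecialLinearGroup.mapGL ℝ s : GL (Fin 2) ℝ) ∈ 𝒮ℒ := ⟨s, rfl⟩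

include hg in
omit [NeZero N] in
/-- **Representatives of translated cosets**: for `s ∈ SL(2, ℤ)` and a coset `q`, the chosen
representative `g_{s⁻¹q}` of `s⁻¹ q` satisfies `(g_{s⁻¹q})⁻¹ = γ₁ g_q⁻¹ s` for some `γ₁ ∈ Γ₀(N)`. [folklore] -/
theorem exists_rep_inv_smul (s : SL(2, ℤ))
    (q : ↥𝒮ℒ ⧸ (Gamma0 N : Subgroup (GL (Fin 2) ℝ)).subgroupOf 𝒮ℒ) :
    ∃ γ₁ : SL(2, ℤ), γ₁ ∈ Gamma0 N ∧
      (g ((⟨Matrix.SpecialLinearGroup.mapGL ℝ s, mem_SL_range s⟩ : ↥𝒮ℒ)⁻¹ • q))⁻¹ = γ₁ * ((g q)⁻¹ * s) := by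
  set a : ↥𝒮ℒ := ⟨Matrix.SpecialLinearGroup.mapGL ℝ s, mem_SL_range s⟩ with ha
  set q' := a⁻¹ • q with hq'
  -- `q' = mk (a⁻¹ * q.out)`
  have hq'mk : q' = QuotientGroup.mk (a⁻¹ * q.out) := by
    rw [hq']
    conv_lhs => rw [← QuotientGroup.out_eq' q]
    rw [MulAction.Quotient.smul_mk, smul_eq_mul]
  have hmem : (q'.out : ↥𝒮ℒ)⁻¹ * (a⁻¹ * q.out) ∈ ((Gamma0 N : Subgroup (GL (Fin 2) ℝ)).subgroupOf 𝒮ℒ) := by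
    rw [← QuotientGroup.eq, QuotientGroup.out_eq', hq'mk]
  rw [Subgroup.mem_subgroupOf, Subgroup.coe_mul, Subgroup.coe_mul, Subgroup.coe_inv, Subgroup.coe_inv,
    ← hg q', ← hg q, ha] at hmem
  simp only [← map_inv, ← map_mul] at hmem
  rw [Subgroup.mem_map_iff_mem (Matrix.SpecialLinearGroup.mapGL_injective (R := ℤ) (S := ℝ))] at hmem
  refine ⟨(g q')⁻¹ * (s⁻¹ * g q), hmem, ?_⟩
  group

include hg in
omit [NeZero N] in
/-- **Slashing by the representative of a translated coset**:
`f ∣ g_{s⁻¹q}⁻¹ = f ∣ (g_q⁻¹ s)` for `f ∈ S_k(Γ₀(N))`. [folklore] -/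
theorem slash_rep_inv_smul (f : CuspForm (Gamma0 N) (n + 2)) (s : SL(2, ℤ))
    (q : ↥𝒮ℒ ⧸ (Gamma0 N : Subgroup (GL (Fin 2) ℝ)).subgroupOf 𝒮ℒ) :
    ⇑f ∣[(n + 2 : ℤ)] (g ((⟨Matrix.SpecialLinearGroup.mapGL ℝ s, mem_SL_range s⟩ : ↥𝒮ℒ)⁻¹ • q))⁻¹ =
      ⇑f ∣[(n + 2 : ℤ)] ((g q)⁻¹ * s) := by
  obtain ⟨γ₁, hγ₁, hrep⟩ := exists_rep_inv_smul g hg s q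
  rw [hrep, SlashAction.slash_mul, slash_gamma0_eq_self f ⟨γ₁, hγ₁⟩]

omit [NeZero N] in
/-- Reindexing a sum over cosets by the translation `q ↦ a • q`. [folklore] -/
theorem sum_smul_eq {M : Type*} [AddCommMonoid M]
    [Fintype (↥𝒮ℒ ⧸ (Gamma0 N : Subgroup (GL (Fin 2) ℝ)).subgroupOf 𝒮ℒ)]
    (F : (↥𝒮ℒ ⧸ (Gamma0 N : Subgroup (GL (Fin 2) ℝ)).subgroupOf 𝒮ℒ) → M) (a : ↥𝒮ℒ) :
    ∑ q, F (a • q) = ∑ q, F q :=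
  Fintype.sum_bijective _ (MulAction.bijective a) _ _ fun _ ↦ rfl

end Cosets

/-! ### The vertical sides cancel -/

section Vertical

variable (g : (↥𝒮ℒ ⧸ (Gamma0 N : Subgroup (GL (Fin 2) ℝ)).subgroupOf 𝒮ℒ) → SL(2, ℤ))
  (hg : ∀ q, (Matrix.SpecialLinearGroup.mapGL ℝ (g q) : GL (Fin 2) ℝ) = ((q.out : ↥𝒮ℒ) : GL (Fin 2) ℝ))

/-- `T` moves the left side of `𝔉` to the right side: `T(-½ + it) = ½ + it`. [folklore] -/
theorem T_smul_left_side {t : ℝ} (ht : 0 < t) :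
    T • ofComplex ((((-(1 / 2) : ℝ)) : ℂ) + t * I) = ofComplex ((((1 / 2 : ℝ)) : ℂ) + t * I) := by
  have h1 : 0 < ((((-(1 / 2) : ℝ)) : ℂ) + t * I).im := by simpa using ht
  have h2 : 0 < ((((1 / 2 : ℝ)) : ℂ) + t * I).im := by simpa using ht
  apply UpperHalfPlane.ext
  rw [modular_T_smul, coe_vadd, ofComplex_apply_of_im_pos h1, ofComplex_apply_of_im_pos h2]
  push_cast
  ring

/-- **`F_{AT} ḡ_{AT}` on the left side equals `F_A ḡ_A` on the right side** (PP §8.2: the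
integrals over the vertical sides of `𝔉` cancel since `F_{AT}(z) = F_A(Tz)`). [cite: PasolPopa2013, §8.2 (proof of Thm. 8.6)] -/
theorem integrand_left_eq_right (f G : CuspForm (Gamma0 N) (n + 2)) (A : SL(2, ℤ)) {t : ℝ} (ht : 0 < t) :
    eichlerKernel n (⇑f ∣[(n + 2 : ℤ)] (A * T)) (ofComplex ((((-(1 / 2) : ℝ)) : ℂ) + t * I))
        ![conj ((((-(1 / 2) : ℝ)) : ℂ) + t * I), 1] *
      conj ((⇑G ∣[(n + 2 : ℤ)] (A * T)) (ofComplex ((((-(1 / 2) : ℝ)) : ℂ) + t * I))) =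
    eichlerKernel n (⇑f ∣[(n + 2 : ℤ)] A) (ofComplex ((((1 / 2 : ℝ)) : ℂ) + t * I))
        ![conj ((((1 / 2 : ℝ)) : ℂ) + t * I), 1] *
      conj ((⇑G ∣[(n + 2 : ℤ)] A) (ofComplex ((((1 / 2 : ℝ)) : ℂ) + t * I))) := by
  have h1 : 0 < ((((-(1 / 2) : ℝ)) : ℂ) + t * I).im := by simpa using ht
  have h2 : 0 < ((((1 / 2 : ℝ)) : ℂ) + t * I).im := by simpa using ht
  set z : ℍ := ofComplex ((((-(1 / 2) : ℝ)) : ℂ) + t * I) with hz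
  have hzc : (z : ℂ) = (((-(1 / 2) : ℝ)) : ℂ) + t * I := by
    rw [hz, ofComplex_apply_of_im_pos h1, coe_mk]
  have hTz : T • z = ofComplex ((((1 / 2 : ℝ)) : ℂ) + t * I) := T_smul_left_side ht
  have hTzc : ((T • z : ℍ) : ℂ) = (((1 / 2 : ℝ)) : ℂ) + t * I := by
    rw [hTz, ofComplex_apply_of_im_pos h2, coe_mk]
  rw [← hzc, eichlerKernel_T_smul, ← slash_apply_T_smul, hTzc, hTz]

include hg in
/-- **The vertical sides cancel after summing over the cosets**:
`∑_q ∫ P_q(-½ + it) dt = ∑_q ∫ P_q(½ + it) dt` (reindex by `q ↦ T⁻¹ q`). [cite: PasolPopa2013, §8.2 (proof of Thm. 8.6)] -/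
theorem sum_left_eq_sum_right [Fintype (↥𝒮ℒ ⧸ (Gamma0 N : Subgroup (GL (Fin 2) ℝ)).subgroupOf 𝒮ℒ)]
    (f G : CuspForm (Gamma0 N) (n + 2)) :
    ∑ q, ∫ t in Ioi (Real.sqrt (1 - (-(1 / 2) : ℝ) ^ 2)),
        eichlerKernel n (⇑f ∣[(n + 2 : ℤ)] (g q)⁻¹) (ofComplex ((((-(1 / 2) : ℝ)) : ℂ) + t * I))
            ![conj ((((-(1 / 2) : ℝ)) : ℂ) + t * I), 1] *
          conj ((⇑G ∣[(n + 2 : ℤ)] (g q)⁻¹) (ofComplex ((((-(1 / 2) : ℝ)) : ℂ) + t * I))) =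
      ∑ q, ∫ t in Ioi (Real.sqrt (1 - (1 / 2 : ℝ) ^ 2)),
        eichlerKernel n (⇑f ∣[(n + 2 : ℤ)] (g q)⁻¹) (ofComplex ((((1 / 2 : ℝ)) : ℂ) + t * I))
            ![conj ((((1 / 2 : ℝ)) : ℂ) + t * I), 1] *
          conj ((⇑G ∣[(n + 2 : ℤ)] (g q)⁻¹) (ofComplex ((((1 / 2 : ℝ)) : ℂ) + t * I))) := by
  set a : ↥𝒮ℒ := ⟨Matrix.SpecialLinearGroup.mapGL ℝ T, mem_SL_range T⟩ with ha
  rw [← sum_smul_eq (a := a⁻¹) (F := fun q ↦ ∫ t in Ioi (Real.sqrt (1 - (-(1 / 2) : ℝ) ^ 2)),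
        eichlerKernel n (⇑f ∣[(n + 2 : ℤ)] (g q)⁻¹) (ofComplex ((((-(1 / 2) : ℝ)) : ℂ) + t * I))
            ![conj ((((-(1 / 2) : ℝ)) : ℂ) + t * I), 1] *
          conj ((⇑G ∣[(n + 2 : ℤ)] (g q)⁻¹) (ofComplex ((((-(1 / 2) : ℝ)) : ℂ) + t * I))))]
  refine Finset.sum_congr rfl fun q _ ↦ ?_
  rw [ha, slash_rep_inv_smul g hg f T q, slash_rep_inv_smul g hg G T q,
    show (-(1 / 2) : ℝ) ^ 2 = (1 / 2 : ℝ) ^ 2 by norm_num]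
  refine setIntegral_congr_fun measurableSet_Ioi fun t ht ↦ ?_
  have ht0 : 0 < t := (Real.sqrt_nonneg _).trans_lt ht
  exact integrand_left_eq_right f G (g q)⁻¹ ht0

end Vertical

/-! ### The arc: `S`-symmetrisation and the pairing with `H_{ρ²} - H_ρ` -/

section Arc

variable {h : ℝ} {ψ : ℍ → ℂ}

/-- The complex arc `ζ(x) = x + i√(1-x²)` has derivative `ζ'(x) = 1 - i x/√(1-x²)`. [folklore] -/
theorem hasDerivAt_arcC {x : ℝ} (hx : x ∈ Icc (-(1 / 2) : ℝ) (1 / 2)) :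
    HasDerivAt (fun u : ℝ ↦ (u : ℂ) + Real.sqrt (1 - u ^ 2) * I)
      (1 + ((-x / Real.sqrt (1 - x ^ 2) : ℝ) : ℂ) * I) x := by
  have h1 : HasDerivAt (fun u : ℝ ↦ ((id u : ℝ) : ℂ)) ((1 : ℝ) : ℂ) x := (hasDerivAt_id x).ofReal_comp
  have h2 : HasDerivAt (fun u : ℝ ↦ ((Real.sqrt (1 - u ^ 2) : ℝ) : ℂ) * I)
      (((-x / Real.sqrt (1 - x ^ 2) : ℝ) : ℂ) * I) x :=
    (HaberlandStokes.hasDerivAt_arc hx).ofReal_comp.mul_const I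
  have e : (fun u : ℝ ↦ (u : ℂ) + Real.sqrt (1 - u ^ 2) * I) =
      ((fun u : ℝ ↦ ((id u : ℝ) : ℂ)) + fun u : ℝ ↦ ((Real.sqrt (1 - u ^ 2) : ℝ) : ℂ) * I) := rfl
  rw [e]
  refine (h1.add h2).congr_deriv ?_
  simp

/-- Continuity of the arc and of the `dz̄`-factor on `[-1/2, 1/2]`. [folklore] -/
theorem continuousOn_arc :
    ContinuousOn (fun u : ℝ ↦ (u : ℂ) + Real.sqrt (1 - u ^ 2) * I) (Icc (-(1 / 2) : ℝ) (1 / 2)) ∧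
    MapsTo (fun u : ℝ ↦ (u : ℂ) + Real.sqrt (1 - u ^ 2) * I) (Icc (-(1 / 2) : ℝ) (1 / 2)) {z : ℂ | 0 < z.im} ∧
    ContinuousOn (fun u : ℝ ↦ (1 + ((-u / Real.sqrt (1 - u ^ 2) : ℝ) : ℂ) * I)) (Icc (-(1 / 2) : ℝ) (1 / 2)) ∧
    ContinuousOn (fun u : ℝ ↦ (1 - ((-u / Real.sqrt (1 - u ^ 2) : ℝ) : ℂ) * I)) (Icc (-(1 / 2) : ℝ) (1 / 2)) := by
  have hD := continuous_ofReal.comp_continuousOn HaberlandStokes.continuousOn_arc_deriv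
  refine ⟨by fun_prop, fun u hu ↦ arc_im_pos hu, ?_, ?_⟩
  · exact continuousOn_const.add (hD.mul continuousOn_const)
  · exact continuousOn_const.sub (hD.mul continuousOn_const)

/-- **The arc integral of `tᵐ ψ(t) dt` as a difference of primitives** (fundamental theorem of
calculus for `x ↦ ∫_{ζ(x)}^{i∞} ψ tᵐ dt`, `d/dz ∫_z^{i∞} ψ tᵐ = -ψ zᵐ`):
`∫_{-1/2}^{1/2} ζᵐ ψ(ζ) ζ' dx = ∫_{ρ²}^{i∞} ψ tᵐ dt - ∫_{ρ}^{i∞} ψ tᵐ dt`, `ρ² = ζ(-½)`, `ρ = ζ(½)`. [folklore] -/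
theorem intervalIntegral_arc_pow_mul (hψ : IsCuspFunction h ψ) (m : ℕ) :
    ∫ x in (-(1 / 2) : ℝ)..(1 / 2), ((x : ℂ) + Real.sqrt (1 - x ^ 2) * I) ^ m *
        ψ (ofComplex ((x : ℂ) + Real.sqrt (1 - x ^ 2) * I)) *
        (1 + ((-x / Real.sqrt (1 - x ^ 2) : ℝ) : ℂ) * I) =
      powPrimitive m ψ (ofComplex ((((-(1 / 2) : ℝ)) : ℂ) + Real.sqrt (1 - (-(1 / 2) : ℝ) ^ 2) * I)) -
        powPrimitive m ψ (ofComplex ((((1 / 2 : ℝ)) : ℂ) + Real.sqrt (1 - (1 / 2 : ℝ) ^ 2) * I)) := by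
  obtain ⟨harcc, hmaps, hDc, -⟩ := continuousOn_arc
  have hderiv : ∀ x ∈ Icc (-(1 / 2) : ℝ) (1 / 2),
      HasDerivAt (fun u : ℝ ↦ powPrimitive m ψ (ofComplex ((u : ℂ) + Real.sqrt (1 - u ^ 2) * I)))
        (-(ψ (ofComplex ((x : ℂ) + Real.sqrt (1 - x ^ 2) * I)) * ((x : ℂ) + Real.sqrt (1 - x ^ 2) * I) ^ m) *
          (1 + ((-x / Real.sqrt (1 - x ^ 2) : ℝ) : ℂ) * I)) x := by
    intro x hx
    exact (hψ.hasDerivAt_powPrimitive m (arc_im_pos hx)).comp x (hasDerivAt_arcC hx)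
  have hcont : ContinuousOn
      (fun u : ℝ ↦ powPrimitive m ψ (ofComplex ((u : ℂ) + Real.sqrt (1 - u ^ 2) * I)))
      (Icc (-(1 / 2) : ℝ) (1 / 2)) := fun x hx ↦ (hderiv x hx).continuousAt.continuousWithinAt
  have hψc : ContinuousOn (fun w : ℂ ↦ ψ (ofComplex w)) {z : ℂ | 0 < z.im} := hψ.continuousOn_comp_ofComplex
  have hder_cont : ContinuousOn (fun x : ℝ ↦
      (-(ψ (ofComplex ((x : ℂ) + Real.sqrt (1 - x ^ 2) * I)) * ((x : ℂ) + Real.sqrt (1 - x ^ 2) * I) ^ m) *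
        (1 + ((-x / Real.sqrt (1 - x ^ 2) : ℝ) : ℂ) * I))) (Icc (-(1 / 2) : ℝ) (1 / 2)) :=
    (((hψc.comp harcc hmaps).mul (harcc.pow m)).neg).mul hDc
  have hFTC := intervalIntegral.integral_eq_sub_of_hasDerivAt_of_le (by norm_num : (-(1 / 2) : ℝ) ≤ 1 / 2)
    hcont (fun x hx ↦ hderiv x (Ioo_subset_Icc_self hx)) (hder_cont.intervalIntegrable_of_Icc (by norm_num))
  have hneg : ∫ x in (-(1 / 2) : ℝ)..(1 / 2), ((x : ℂ) + Real.sqrt (1 - x ^ 2) * I) ^ m *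
        ψ (ofComplex ((x : ℂ) + Real.sqrt (1 - x ^ 2) * I)) *
        (1 + ((-x / Real.sqrt (1 - x ^ 2) : ℝ) : ℂ) * I) =
      -∫ x in (-(1 / 2) : ℝ)..(1 / 2),
        (-(ψ (ofComplex ((x : ℂ) + Real.sqrt (1 - x ^ 2) * I)) * ((x : ℂ) + Real.sqrt (1 - x ^ 2) * I) ^ m) *
          (1 + ((-x / Real.sqrt (1 - x ^ 2) : ℝ) : ℂ) * I)) := by
    rw [← intervalIntegral.integral_neg]
    refine intervalIntegral.integral_congr fun x _ ↦ ?_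
    ring
  rw [hneg, hFTC]
  ring

/-- Interval integral of a conjugate. [folklore] -/
theorem intervalIntegral_conj (F : ℝ → ℂ) {a b : ℝ} (hab : a ≤ b) :
    ∫ x in a..b, conj (F x) = conj (∫ x in a..b, F x) := by
  rw [intervalIntegral.integral_of_le hab, intervalIntegral.integral_of_le hab, integral_conj]

/-- **The arc term as a pairing** (Paşol–Popa §8.2: "Using
`∫_ρ^{ρ²} ḡ_A(z)(z̄ - X)^w dz̄ = H̄_ρ(A) - H̄_{ρ²}(A)` and (3.3) we get
`∫_ρ^{ρ²} ρ_f(A)(z̄) ḡ_A(z) dz̄ = ⟨ρ_f(A), H̄_ρ(A) - H̄_{ρ²}(A)⟩`"): for even `n`, a moment vector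
`r` and a cusp function `ψ`, with `ζ(x) = x + i√(1-x²)` running from `ρ² = ζ(-½)` to `ρ = ζ(½)`,
`∫_{-1/2}^{1/2} (momPoly r)(\overline{ζ}, 1) \overline{ψ(ζ)} \overline{ζ'} dx
  = invForm r (\overline{H_{ρ²} - H_ρ})`, `(H_{z₀})_m = ∫_{z₀}^{i∞} ψ tᵐ dt`. [cite: PasolPopa2013, §8.2 (proof of Thm. 8.6) and (3.3)] -/
theorem intervalIntegral_momPoly_arc (hn : Even n) (hψ : IsCuspFunction h ψ) (r : Fin (n + 1) → ℂ) :
    ∫ x in (-(1 / 2) : ℝ)..(1 / 2), momPoly n r ![conj ((x : ℂ) + Real.sqrt (1 - x ^ 2) * I), 1] *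
        conj (ψ (ofComplex ((x : ℂ) + Real.sqrt (1 - x ^ 2) * I))) *
        (1 - ((-x / Real.sqrt (1 - x ^ 2) : ℝ) : ℂ) * I) =
      invForm n r (fun j ↦ conj
        (powPrimitive j ψ (ofComplex ((((-(1 / 2) : ℝ)) : ℂ) + Real.sqrt (1 - (-(1 / 2) : ℝ) ^ 2) * I)) -
          powPrimitive j ψ (ofComplex ((((1 / 2 : ℝ)) : ℂ) + Real.sqrt (1 - (1 / 2 : ℝ) ^ 2) * I)))) := by
  set F : ℕ → ℝ → ℂ := fun m x ↦ ((x : ℂ) + Real.sqrt (1 - x ^ 2) * I) ^ m *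
    ψ (ofComplex ((x : ℂ) + Real.sqrt (1 - x ^ 2) * I)) * (1 + ((-x / Real.sqrt (1 - x ^ 2) : ℝ) : ℂ) * I)
    with hF
  have hpt : ∀ x : ℝ, momPoly n r ![conj ((x : ℂ) + Real.sqrt (1 - x ^ 2) * I), 1] *
      conj (ψ (ofComplex ((x : ℂ) + Real.sqrt (1 - x ^ 2) * I))) *
      (1 - ((-x / Real.sqrt (1 - x ^ 2) : ℝ) : ℂ) * I) =
      ∑ j : Fin (n + 1), ((-1) ^ (j : ℕ) * (n.choose j : ℂ) * r j) * conj (F (n - j) x) := by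
    intro x
    rw [← invForm_powVec_right hn, invForm_apply, Finset.sum_mul, Finset.sum_mul]
    refine Finset.sum_congr rfl fun j _ ↦ ?_
    simp only [hF, powVec_apply, val_rev_eq, map_mul, map_pow, map_add, Complex.conj_ofReal,
      Complex.conj_I, map_one]
    ring
  simp_rw [hpt]
  obtain ⟨harcc, hmaps, hDc, -⟩ := continuousOn_arc
  have hψc : ContinuousOn (fun w : ℂ ↦ ψ (ofComplex w)) {z : ℂ | 0 < z.im} := hψ.continuousOn_comp_ofComplex
  have hFc : ∀ m, ContinuousOn (F m) (Icc (-(1 / 2) : ℝ) (1 / 2)) := fun m ↦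
    ((harcc.pow m).mul (hψc.comp harcc hmaps)).mul hDc
  have hint : ∀ j : Fin (n + 1), IntervalIntegrable
      (fun x ↦ ((-1) ^ (j : ℕ) * (n.choose j : ℂ) * r j) * conj (F (n - j) x)) volume (-(1 / 2) : ℝ) (1 / 2) :=
    fun j ↦ ((continuousOn_const.mul (Complex.continuous_conj.comp_continuousOn (hFc _))).intervalIntegrable_of_Icc
      (by norm_num))
  rw [intervalIntegral.integral_finsetSum (fun j _ ↦ hint j), invForm_apply]
  refine Finset.sum_congr rfl fun j _ ↦ ?_
  rw [intervalIntegral.integral_const_mul, intervalIntegral_conj _ (by norm_num), hF]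
  simp only [val_rev_eq]
  rw [intervalIntegral_arc_pow_mul hψ (n - j)]

/-- Continuity of `c ↦ (momPoly v)(c, 1)` (a polynomial). [folklore] -/
theorem continuous_momPoly_pair (v : Fin (n + 1) → ℂ) : Continuous fun c : ℂ ↦ momPoly n v ![c, 1] := by
  simp only [momPoly_apply, Matrix.cons_val_one, Matrix.cons_val_zero]
  fun_prop

/-- Continuity on `[-1/2, 1/2]` of the arc integrand `G_B(x) = F_B(ζ) \overline{g_B(ζ)} D(x)` and of
the period term `ρ_f(B)(\overline{ζ}) \overline{g_B(ζ)} D(x)`. [folklore] -/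
theorem continuousOn_arc_terms (f G : CuspForm (Gamma0 N) (n + 2)) (B : SL(2, ℤ)) (v : Fin (n + 1) → ℂ) :
    ContinuousOn (fun x : ℝ ↦
      eichlerKernel n (⇑f ∣[(n + 2 : ℤ)] B) (ofComplex ((x : ℂ) + Real.sqrt (1 - x ^ 2) * I))
          ![conj ((x : ℂ) + Real.sqrt (1 - x ^ 2) * I), 1] *
        conj ((⇑G ∣[(n + 2 : ℤ)] B) (ofComplex ((x : ℂ) + Real.sqrt (1 - x ^ 2) * I))) *
        (1 - ((-x / Real.sqrt (1 - x ^ 2) : ℝ) : ℂ) * I)) (Icc (-(1 / 2) : ℝ) (1 / 2)) ∧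
    ContinuousOn (fun x : ℝ ↦
      momPoly n v ![conj ((x : ℂ) + Real.sqrt (1 - x ^ 2) * I), 1] *
        conj ((⇑G ∣[(n + 2 : ℤ)] B) (ofComplex ((x : ℂ) + Real.sqrt (1 - x ^ 2) * I))) *
        (1 - ((-x / Real.sqrt (1 - x ^ 2) : ℝ) : ℂ) * I)) (Icc (-(1 / 2) : ℝ) (1 / 2)) := by
  obtain ⟨harcc, hmaps, -, hDc⟩ := continuousOn_arc
  have hφ : IsCuspFunction N (⇑f ∣[(n + 2 : ℤ)] B) := isCuspFunction_slash f B
  have hψ : IsCuspFunction N (⇑G ∣[(n + 2 : ℤ)] B) := isCuspFunction_slash G B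
  have hP : ContinuousOn (fun w : ℂ ↦ eichlerKernel n (⇑f ∣[(n + 2 : ℤ)] B) (ofComplex w) ![conj w, 1] *
      conj ((⇑G ∣[(n + 2 : ℤ)] B) (ofComplex w))) {z : ℂ | 0 < z.im} := fun w hw ↦
    (HaberlandStokes.hasFDerivAt_integrand (n := n) hφ hψ hw).continuousAt.continuousWithinAt
  have hGc : ContinuousOn (fun w : ℂ ↦ (⇑G ∣[(n + 2 : ℤ)] B) (ofComplex w)) {z : ℂ | 0 < z.im} :=
    hψ.continuousOn_comp_ofComplex
  refine ⟨(hP.comp harcc hmaps).mul hDc, ?_⟩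
  refine ContinuousOn.mul (ContinuousOn.mul ?_ (Complex.continuous_conj.comp_continuousOn (hGc.comp harcc hmaps))) hDc
  exact (continuous_momPoly_pair v).comp_continuousOn (Complex.continuous_conj.comp_continuousOn harcc)

/-- **`S`-symmetrisation of one arc integral**: with `G_A(x) = F_A(ζ)\overline{g_A(ζ)} \overline{ζ'}`,
`∫_{-1/2}^{1/2} G_A = -∫_{-1/2}^{1/2} G_{AS} + ∫_{-1/2}^{1/2} ρ_f(AS)(\overline{ζ}) \overline{g_{AS}(ζ)} \overline{ζ'} dx`
(substitute `x ↦ -x`, i.e. `z ↦ Sz`, and use `arc_integrand_neg`). [cite: PasolPopa2013, §8.2 (proof of Thm. 8.6)] -/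
theorem intervalIntegral_arc_eq (hn : Even n) (f G : CuspForm (Gamma0 N) (n + 2)) (A : SL(2, ℤ)) :
    ∫ x in (-(1 / 2) : ℝ)..(1 / 2),
        eichlerKernel n (⇑f ∣[(n + 2 : ℤ)] A) (ofComplex ((x : ℂ) + Real.sqrt (1 - x ^ 2) * I))
            ![conj ((x : ℂ) + Real.sqrt (1 - x ^ 2) * I), 1] *
          conj ((⇑G ∣[(n + 2 : ℤ)] A) (ofComplex ((x : ℂ) + Real.sqrt (1 - x ^ 2) * I))) *
          (1 - ((-x / Real.sqrt (1 - x ^ 2) : ℝ) : ℂ) * I) =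
      -(∫ x in (-(1 / 2) : ℝ)..(1 / 2),
        eichlerKernel n (⇑f ∣[(n + 2 : ℤ)] (A * S)) (ofComplex ((x : ℂ) + Real.sqrt (1 - x ^ 2) * I))
            ![conj ((x : ℂ) + Real.sqrt (1 - x ^ 2) * I), 1] *
          conj ((⇑G ∣[(n + 2 : ℤ)] (A * S)) (ofComplex ((x : ℂ) + Real.sqrt (1 - x ^ 2) * I))) *
          (1 - ((-x / Real.sqrt (1 - x ^ 2) : ℝ) : ℂ) * I)) +
      ∫ x in (-(1 / 2) : ℝ)..(1 / 2),
        momPoly n (fun j ↦ msymbMoment n (A * S) j f) ![conj ((x : ℂ) + Real.sqrt (1 - x ^ 2) * I), 1] *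
          conj ((⇑G ∣[(n + 2 : ℤ)] (A * S)) (ofComplex ((x : ℂ) + Real.sqrt (1 - x ^ 2) * I))) *
          (1 - ((-x / Real.sqrt (1 - x ^ 2) : ℝ) : ℂ) * I) := by
  obtain ⟨hGc, hRc⟩ := continuousOn_arc_terms f G (A * S) (fun j ↦ msymbMoment n (A * S) j f)
  -- substitute `x ↦ -x`
  have hsymm : ∫ x in (-(1 / 2) : ℝ)..(1 / 2),
      eichlerKernel n (⇑f ∣[(n + 2 : ℤ)] A) (ofComplex ((((-x : ℝ)) : ℂ) + Real.sqrt (1 - (-x) ^ 2) * I))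
          ![conj ((((-x : ℝ)) : ℂ) + Real.sqrt (1 - (-x) ^ 2) * I), 1] *
        conj ((⇑G ∣[(n + 2 : ℤ)] A) (ofComplex ((((-x : ℝ)) : ℂ) + Real.sqrt (1 - (-x) ^ 2) * I))) *
        (1 - ((-(-x) / Real.sqrt (1 - (-x) ^ 2) : ℝ) : ℂ) * I) =
      ∫ x in (-(1 / 2) : ℝ)..(1 / 2),
      eichlerKernel n (⇑f ∣[(n + 2 : ℤ)] A) (ofComplex ((x : ℂ) + Real.sqrt (1 - x ^ 2) * I))
          ![conj ((x : ℂ) + Real.sqrt (1 - x ^ 2) * I), 1] *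
        conj ((⇑G ∣[(n + 2 : ℤ)] A) (ofComplex ((x : ℂ) + Real.sqrt (1 - x ^ 2) * I))) *
        (1 - ((-x / Real.sqrt (1 - x ^ 2) : ℝ) : ℂ) * I) := by
    have h := intervalIntegral.integral_comp_neg (a := (-(1 / 2) : ℝ)) (b := (1 / 2 : ℝ))
      (f := fun x : ℝ ↦
        eichlerKernel n (⇑f ∣[(n + 2 : ℤ)] A) (ofComplex ((x : ℂ) + Real.sqrt (1 - x ^ 2) * I))
            ![conj ((x : ℂ) + Real.sqrt (1 - x ^ 2) * I), 1] *
          conj ((⇑G ∣[(n + 2 : ℤ)] A) (ofComplex ((x : ℂ) + Real.sqrt (1 - x ^ 2) * I))) *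
          (1 - ((-x / Real.sqrt (1 - x ^ 2) : ℝ) : ℂ) * I))
    rw [show (-(-(1 / 2)) : ℝ) = 1 / 2 by norm_num] at h
    exact h
  rw [← hsymm]
  have hcongr := intervalIntegral.integral_congr (μ := volume) (a := (-(1 / 2) : ℝ)) (b := (1 / 2 : ℝ))
    (fun x hx ↦ arc_integrand_neg hn f G A (x := x) (by rwa [uIcc_of_le (by norm_num)] at hx))
  have hneg : IntervalIntegrable (fun x : ℝ ↦ -(eichlerKernel n (⇑f ∣[(n + 2 : ℤ)] (A * S)) (ofComplex ((x : ℂ) + Real.sqrt (1 - x ^ 2) * I))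
            ![conj ((x : ℂ) + Real.sqrt (1 - x ^ 2) * I), 1] *
          conj ((⇑G ∣[(n + 2 : ℤ)] (A * S)) (ofComplex ((x : ℂ) + Real.sqrt (1 - x ^ 2) * I))) *
          (1 - ((-x / Real.sqrt (1 - x ^ 2) : ℝ) : ℂ) * I))) volume (-(1 / 2) : ℝ) (1 / 2) :=
    (hGc.intervalIntegrable_of_Icc (by norm_num)).neg
  rw [hcongr, intervalIntegral.integral_add hneg (hRc.intervalIntegrable_of_Icc (by norm_num)),
    intervalIntegral.integral_neg]

end Arc

/-! ### Summing over the cosets -/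

section Sum

variable (g : (↥𝒮ℒ ⧸ (Gamma0 N : Subgroup (GL (Fin 2) ℝ)).subgroupOf 𝒮ℒ) → SL(2, ℤ))
  (hg : ∀ q, (Matrix.SpecialLinearGroup.mapGL ℝ (g q) : GL (Fin 2) ℝ) = ((q.out : ↥𝒮ℒ) : GL (Fin 2) ℝ))

include hg in
/-- **Twice the sum of the arc integrals is the sum of the period pairings** (PP (7.11)/(8.11) with
`a_A = 0`: `∑_A ∫_ρ^{ρ²} F_A ḡ_A dz̄ = ½ ∑_A ⟨ρ_f(A), H̄_ρ(A) - H̄_{ρ²}(A)⟩`; here with the arc run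
from `ρ²` to `ρ`). [cite: PasolPopa2013, §8.2 (7.11)] -/
theorem two_mul_sum_arc (hn : Even n)
    [Fintype (↥𝒮ℒ ⧸ (Gamma0 N : Subgroup (GL (Fin 2) ℝ)).subgroupOf 𝒮ℒ)] (f G : CuspForm (Gamma0 N) (n + 2)) :
    2 * ∑ q, ∫ x in (-(1 / 2) : ℝ)..(1 / 2),
        eichlerKernel n (⇑f ∣[(n + 2 : ℤ)] (g q)⁻¹) (ofComplex ((x : ℂ) + Real.sqrt (1 - x ^ 2) * I))
            ![conj ((x : ℂ) + Real.sqrt (1 - x ^ 2) * I), 1] *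
          conj ((⇑G ∣[(n + 2 : ℤ)] (g q)⁻¹) (ofComplex ((x : ℂ) + Real.sqrt (1 - x ^ 2) * I))) *
          (1 - ((-x / Real.sqrt (1 - x ^ 2) : ℝ) : ℂ) * I) =
      ∑ q, invForm n (fun j ↦ msymbMoment n (g q)⁻¹ j f) (fun j ↦ conj
        (powPrimitive j (⇑G ∣[(n + 2 : ℤ)] (g q)⁻¹)
            (ofComplex ((((-(1 / 2) : ℝ)) : ℂ) + Real.sqrt (1 - (-(1 / 2) : ℝ) ^ 2) * I)) -
          powPrimitive j (⇑G ∣[(n + 2 : ℤ)] (g q)⁻¹)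
            (ofComplex ((((1 / 2 : ℝ)) : ℂ) + Real.sqrt (1 - (1 / 2 : ℝ) ^ 2) * I)))) := by
  set a : ↥𝒮ℒ := ⟨Matrix.SpecialLinearGroup.mapGL ℝ S, mem_SL_range S⟩ with ha
  -- the arc integral and the period term as functions of the coset
  set Arc : (↥𝒮ℒ ⧸ (Gamma0 N : Subgroup (GL (Fin 2) ℝ)).subgroupOf 𝒮ℒ) → ℂ := fun q ↦
    ∫ x in (-(1 / 2) : ℝ)..(1 / 2),
        eichlerKernel n (⇑f ∣[(n + 2 : ℤ)] (g q)⁻¹) (ofComplex ((x : ℂ) + Real.sqrt (1 - x ^ 2) * I))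
            ![conj ((x : ℂ) + Real.sqrt (1 - x ^ 2) * I), 1] *
          conj ((⇑G ∣[(n + 2 : ℤ)] (g q)⁻¹) (ofComplex ((x : ℂ) + Real.sqrt (1 - x ^ 2) * I))) *
          (1 - ((-x / Real.sqrt (1 - x ^ 2) : ℝ) : ℂ) * I) with hArc
  set Rint : (↥𝒮ℒ ⧸ (Gamma0 N : Subgroup (GL (Fin 2) ℝ)).subgroupOf 𝒮ℒ) → ℂ := fun q ↦
    ∫ x in (-(1 / 2) : ℝ)..(1 / 2),
        momPoly n (fun j ↦ msymbMoment n (g q)⁻¹ j f) ![conj ((x : ℂ) + Real.sqrt (1 - x ^ 2) * I), 1] *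
          conj ((⇑G ∣[(n + 2 : ℤ)] (g q)⁻¹) (ofComplex ((x : ℂ) + Real.sqrt (1 - x ^ 2) * I))) *
          (1 - ((-x / Real.sqrt (1 - x ^ 2) : ℝ) : ℂ) * I) with hRint
  have hkey : ∀ q, Arc q = -Arc (a⁻¹ • q) + Rint (a⁻¹ • q) := by
    intro q
    obtain ⟨γ₁, hγ₁, hrep⟩ := exists_rep_inv_smul g hg S q
    have hf : ⇑f ∣[(n + 2 : ℤ)] (g (a⁻¹ • q))⁻¹ = ⇑f ∣[(n + 2 : ℤ)] ((g q)⁻¹ * S) := slash_rep_inv_smul g hg f S q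
    have hG : ⇑G ∣[(n + 2 : ℤ)] (g (a⁻¹ • q))⁻¹ = ⇑G ∣[(n + 2 : ℤ)] ((g q)⁻¹ * S) := slash_rep_inv_smul g hg G S q
    have hμ : (fun j ↦ msymbMoment n (g (a⁻¹ • q))⁻¹ j f) = fun j ↦ msymbMoment n ((g q)⁻¹ * S) j f := by
      funext j
      rw [hrep, msymbMoment_gamma0_mul n hγ₁]
    simp only [hArc, hRint, hf, hG, hμ]
    exact intervalIntegral_arc_eq hn f G (g q)⁻¹
  have hsum : ∑ q, Arc q = -∑ q, Arc q + ∑ q, Rint q := by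
    conv_lhs => rw [show (∑ q, Arc q) = ∑ q, (-Arc (a⁻¹ • q) + Rint (a⁻¹ • q)) from
      Finset.sum_congr rfl fun q _ ↦ hkey q]
    rw [Finset.sum_add_distrib, Finset.sum_neg_distrib,
      sum_smul_eq (F := Arc) a⁻¹, sum_smul_eq (F := Rint) a⁻¹]
  have hR : ∀ q, Rint q = invForm n (fun j ↦ msymbMoment n (g q)⁻¹ j f) (fun j ↦ conj
        (powPrimitive j (⇑G ∣[(n + 2 : ℤ)] (g q)⁻¹)
            (ofComplex ((((-(1 / 2) : ℝ)) : ℂ) + Real.sqrt (1 - (-(1 / 2) : ℝ) ^ 2) * I)) -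
          powPrimitive j (⇑G ∣[(n + 2 : ℤ)] (g q)⁻¹)
            (ofComplex ((((1 / 2 : ℝ)) : ℂ) + Real.sqrt (1 - (1 / 2 : ℝ) ^ 2) * I)))) := fun q ↦
    intervalIntegral_momPoly_arc hn (isCuspFunction_slash G (g q)⁻¹) _
  simp_rw [← hR]
  linear_combination hsum

end Sum

/-! ### Assembly: `2 (2i)ⁿ⁺¹ (g, f) = ∑_q ⟨ρ_f(q), \overline{H_{ρ²}(q) - H_ρ(q)}⟩` -/

section Assembly

variable (g : (↥𝒮ℒ ⧸ (Gamma0 N : Subgroup (GL (Fin 2) ℝ)).subgroupOf 𝒮ℒ) → SL(2, ℤ))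
  (hg : ∀ q, (Matrix.SpecialLinearGroup.mapGL ℝ (g q) : GL (Fin 2) ℝ) = ((q.out : ↥𝒮ℒ) : GL (Fin 2) ℝ))

/-- **Integrability of the Petersson integrand of one coset on the vertical rays of `𝔉` and
continuity of the fibre integrals** (from the Stokes package: `yⁿ φ ψ̄ = (2i)^{-(n+1)}(-iP'1 - P'i)`). [folklore] -/
theorem integrable_fibre (φ ψ : ℍ → ℂ) {h₁ h₂ : ℝ} (hφ : IsCuspFunction h₁ φ) (hψ : IsCuspFunction h₂ ψ) (n : ℕ) :
    (∀ x ∈ Icc (-(1 / 2) : ℝ) (1 / 2), IntegrableOn (fun y : ℝ ↦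
      (y : ℂ) ^ n * (φ (ofComplex ((x : ℂ) + y * I)) * conj (ψ (ofComplex ((x : ℂ) + y * I)))))
      (Ioi (Real.sqrt (1 - x ^ 2)))) ∧
    ContinuousOn (fun x : ℝ ↦ ∫ y in Ioi (Real.sqrt (1 - x ^ 2)),
      (y : ℂ) ^ n * (φ (ofComplex ((x : ℂ) + y * I)) * conj (ψ (ofComplex ((x : ℂ) + y * I)))))
      (Icc (-(1 / 2) : ℝ) (1 / 2)) := by
  have hh₂ := hψ.pos
  obtain ⟨P', C, hC0, -, hcontP', -, hbP', hstokes⟩ :=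
    HaberlandStokes.integrand_package hφ hψ n (-(1 / 2)) (1 / 2)
  have hc : 0 < 2 * Real.pi / h₂ := by positivity
  set c₀ : ℂ := ((2 * I) ^ (n + 1))⁻¹ with hc₀
  have hpt : ∀ (x y : ℝ), 0 < y → (y : ℂ) ^ n * (φ (ofComplex ((x : ℂ) + y * I)) *
      conj (ψ (ofComplex ((x : ℂ) + y * I)))) =
      c₀ * (-I * P' ((x : ℂ) + y * I) 1 - P' ((x : ℂ) + y * I) I) := by
    intro x y hy
    have him : 0 < ((x : ℂ) + y * I).im := by simpa using hy
    rw [hstokes _ him]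
    have e : ((x : ℂ) + y * I).im = y := by simp
    rw [e, hc₀]
    have h2I : (2 * I : ℂ) ^ (n + 1) ≠ 0 := pow_ne_zero _ (mul_ne_zero two_ne_zero I_ne_zero)
    field_simp
  constructor
  · intro x hx
    have hd : (1 / 2 : ℝ) ≤ Real.sqrt (1 - x ^ 2) := HaberlandStokes.half_le_arc hx
    have h1 := GreenUHP.integrableOn_vertical_fderiv hcontP' hbP' one_half_pos hc hx hd 1
    have hI := GreenUHP.integrableOn_vertical_fderiv hcontP' hbP' one_half_pos hc hx hd I
    have hint := ((h1.const_mul (-I)).sub hI).const_mul c₀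
    refine (integrableOn_congr_fun (fun y hy ↦ ?_) measurableSet_Ioi).mp hint
    have hy0 : 0 < y := (Real.sqrt_nonneg _).trans_lt hy
    exact (hpt x y hy0).symm
  · have h1 := continuousOn_setIntegral_Ioi_moving_fderiv (a := (-(1 / 2) : ℝ)) (b := (1 / 2 : ℝ))
      (φ := fun x : ℝ ↦ Real.sqrt (1 - x ^ 2)) (φ' := fun x : ℝ ↦ -x / Real.sqrt (1 - x ^ 2))
      hcontP' hbP' hC0 one_half_pos hc (fun x hx ↦ HaberlandStokes.hasDerivAt_arc hx)
      (fun x hx ↦ HaberlandStokes.half_le_arc hx) (1 : ℂ)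
    have hI := continuousOn_setIntegral_Ioi_moving_fderiv (a := (-(1 / 2) : ℝ)) (b := (1 / 2 : ℝ))
      (φ := fun x : ℝ ↦ Real.sqrt (1 - x ^ 2)) (φ' := fun x : ℝ ↦ -x / Real.sqrt (1 - x ^ 2))
      hcontP' hbP' hC0 one_half_pos hc (fun x hx ↦ HaberlandStokes.hasDerivAt_arc hx)
      (fun x hx ↦ HaberlandStokes.half_le_arc hx) I
    have h2 : ContinuousOn (fun x : ℝ ↦ c₀ * (-I * (∫ t in Ioi (Real.sqrt (1 - x ^ 2)), P' ((x : ℂ) + t * I) 1) -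
        ∫ t in Ioi (Real.sqrt (1 - x ^ 2)), P' ((x : ℂ) + t * I) I)) (Icc (-(1 / 2) : ℝ) (1 / 2)) :=
      continuousOn_const.mul ((continuousOn_const.mul h1).sub hI)
    refine h2.congr fun x hx ↦ ?_
    have hd : (1 / 2 : ℝ) ≤ Real.sqrt (1 - x ^ 2) := HaberlandStokes.half_le_arc hx
    have hi1 := GreenUHP.integrableOn_vertical_fderiv hcontP' hbP' one_half_pos hc hx hd 1
    have hiI := GreenUHP.integrableOn_vertical_fderiv hcontP' hbP' one_half_pos hc hx hd I
    dsimp only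
    rw [← integral_const_mul, ← integral_sub (hi1.const_mul (-I)) hiI, ← integral_const_mul]
    refine setIntegral_congr_fun measurableSet_Ioi fun y hy ↦ ?_
    exact hpt x y ((Real.sqrt_nonneg _).trans_lt hy)

include hg in
/-- **The Petersson product as the sum of the arc integrals** (PP §8.2 for cusp forms:
`C_k C_Γ (f, g) = ∑_A ∫_{∂𝔉} -F_A ḡ_A dz̄ = ∑_A ∫_ρ^{ρ²} F_A ḡ_A dz̄`, the vertical sides
cancelling): `(2i)ⁿ⁺¹ · peterssonProduct Γ₀(N) (n+2) g f = ∑_q ∫_{arc: ρ² → ρ} F_q ḡ_q dz̄`. [cite: PasolPopa2013, §8.2 (proof of Thm. 8.6)] -/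
theorem petersson_eq_sum_arc
    [Fintype (↥𝒮ℒ ⧸ (Gamma0 N : Subgroup (GL (Fin 2) ℝ)).subgroupOf 𝒮ℒ)] (f G : CuspForm (Gamma0 N) (n + 2)) :
    (2 * I) ^ (n + 1) * peterssonProduct (Gamma0 N) (n + 2) G f =
      ∑ q, ∫ x in (-(1 / 2) : ℝ)..(1 / 2),
        eichlerKernel n (⇑f ∣[(n + 2 : ℤ)] (g q)⁻¹) (ofComplex ((x : ℂ) + Real.sqrt (1 - x ^ 2) * I))
            ![conj ((x : ℂ) + Real.sqrt (1 - x ^ 2) * I), 1] *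
          conj ((⇑G ∣[(n + 2 : ℤ)] (g q)⁻¹) (ofComplex ((x : ℂ) + Real.sqrt (1 - x ^ 2) * I))) *
          (1 - ((-x / Real.sqrt (1 - x ^ 2) : ℝ) : ℂ) * I) := by
  rw [peterssonProduct_eq_intervalIntegral g hg (n + 2) G f]
  -- rewrite the Petersson integrand fibrewise as `∑_q yⁿ f_q ḡ_q`
  have hfib : ∀ q, (∀ x ∈ Icc (-(1 / 2) : ℝ) (1 / 2), IntegrableOn (fun y : ℝ ↦
      (y : ℂ) ^ n * ((⇑f ∣[(n + 2 : ℤ)] (g q)⁻¹) (ofComplex ((x : ℂ) + y * I)) *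
        conj ((⇑G ∣[(n + 2 : ℤ)] (g q)⁻¹) (ofComplex ((x : ℂ) + y * I)))))
      (Ioi (Real.sqrt (1 - x ^ 2)))) ∧
    ContinuousOn (fun x : ℝ ↦ ∫ y in Ioi (Real.sqrt (1 - x ^ 2)),
      (y : ℂ) ^ n * ((⇑f ∣[(n + 2 : ℤ)] (g q)⁻¹) (ofComplex ((x : ℂ) + y * I)) *
        conj ((⇑G ∣[(n + 2 : ℤ)] (g q)⁻¹) (ofComplex ((x : ℂ) + y * I)))))
      (Icc (-(1 / 2) : ℝ) (1 / 2)) := fun q ↦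
    integrable_fibre _ _ (isCuspFunction_slash f (g q)⁻¹) (isCuspFunction_slash G (g q)⁻¹) n
  have hinner : ∀ x ∈ Icc (-(1 / 2) : ℝ) (1 / 2), ∫ y in Ioi (Real.sqrt (1 - x ^ 2)),
      ∑ q, conj ((⇑G ∣[(n + 2 : ℤ)] (g q)⁻¹) (ofComplex ((x : ℂ) + y * I))) *
        (⇑f ∣[(n + 2 : ℤ)] (g q)⁻¹) (ofComplex ((x : ℂ) + y * I)) * (y : ℂ) ^ ((n : ℤ) + 2 - 2) =
      ∑ q, ∫ y in Ioi (Real.sqrt (1 - x ^ 2)),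
        (y : ℂ) ^ n * ((⇑f ∣[(n + 2 : ℤ)] (g q)⁻¹) (ofComplex ((x : ℂ) + y * I)) *
          conj ((⇑G ∣[(n + 2 : ℤ)] (g q)⁻¹) (ofComplex ((x : ℂ) + y * I)))) := by
    intro x hx
    rw [← integral_finsetSum _ (fun q _ ↦ (hfib q).1 x hx)]
    refine setIntegral_congr_fun measurableSet_Ioi fun y _ ↦ ?_
    refine Finset.sum_congr rfl fun q _ ↦ ?_
    rw [show ((n : ℤ) + 2 - 2) = ((n : ℕ) : ℤ) by ring, zpow_natCast]
    ring
  rw [intervalIntegral.integral_congr (fun x hx ↦ hinner x (by rwa [uIcc_of_le (by norm_num)] at hx)),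
    intervalIntegral.integral_finsetSum (fun q _ ↦ ((hfib q).2).intervalIntegrable_of_Icc (by norm_num)),
    Finset.mul_sum]
  -- Stokes on each coset, then the vertical sides cancel
  have hq : ∀ q, (2 * I) ^ (n + 1) * ∫ x in (-(1 / 2) : ℝ)..(1 / 2), ∫ y in Ioi (Real.sqrt (1 - x ^ 2)),
      (y : ℂ) ^ n * ((⇑f ∣[(n + 2 : ℤ)] (g q)⁻¹) (ofComplex ((x : ℂ) + y * I)) *
        conj ((⇑G ∣[(n + 2 : ℤ)] (g q)⁻¹) (ofComplex ((x : ℂ) + y * I)))) = _ := fun q ↦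
    HaberlandStokes.stokes_fd (isCuspFunction_slash f (g q)⁻¹) (isCuspFunction_slash G (g q)⁻¹) n
  simp_rw [hq, Finset.sum_add_distrib, Finset.sum_sub_distrib, ← Finset.mul_sum,
    sum_left_eq_sum_right g hg f G]
  ring

include hg in
/-- **Haberland's formula, intermediate form on the standard fundamental domain** (Paşol–Popa
(7.11)/(8.11) with `a_A = 0`, i.e. for cusp forms:
`C_k C_Γ (f,g) = ½ ∑_A ⟨ρ_f(A), H̄_ρ(A) - H̄_{ρ²}(A)⟩`, `C_k = -(2i)^{k-1}`,
`H_{z₀}(A) = ∫_{z₀}^{i∞} g_A(t)(t - X)^w dt`): in the tree's normalisation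
(`peterssonProduct Γ₀(N) k g f = ∫_{Γ₀(N)\ℍ} ḡ f yᵏ dμ = C_Γ (f,g)`, antilinear in the first
variable) and in moment coordinates (`ρ_f(A) ↔ msymbMoment n A · f`, `H_{z₀}(A) ↔ momVec (g∣A) z₀`,
`⟨·,·⟩ ↔ invForm`), for even `n`,
`2 (2i)ⁿ⁺¹ · peterssonProduct Γ₀(N) (n+2) g f
   = ∑_q invForm (μ_f(g_q⁻¹)) (\overline{H_{ρ²}(g_q⁻¹) - H_ρ(g_q⁻¹)})`. [cite: PasolPopa2013, §8.2 (7.11) and Thm. 3.2] -/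
theorem two_mul_petersson_eq_sum_invForm (hn : Even n)
    [Fintype (↥𝒮ℒ ⧸ (Gamma0 N : Subgroup (GL (Fin 2) ℝ)).subgroupOf 𝒮ℒ)] (f G : CuspForm (Gamma0 N) (n + 2)) :
    2 * (2 * I) ^ (n + 1) * peterssonProduct (Gamma0 N) (n + 2) G f =
      ∑ q, invForm n (fun j ↦ msymbMoment n (g q)⁻¹ j f) (fun j ↦ conj
        (powPrimitive j (⇑G ∣[(n + 2 : ℤ)] (g q)⁻¹)
            (ofComplex ((((-(1 / 2) : ℝ)) : ℂ) + Real.sqrt (1 - (-(1 / 2) : ℝ) ^ 2) * I)) -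
          powPrimitive j (⇑G ∣[(n + 2 : ℤ)] (g q)⁻¹)
            (ofComplex ((((1 / 2 : ℝ)) : ℂ) + Real.sqrt (1 - (1 / 2 : ℝ) ^ 2) * I)))) := by
  rw [mul_assoc, petersson_eq_sum_arc g hg f G, two_mul_sum_arc g hg hn f G]

end Assembly

end HaberlandBoundary

end Literature.NumberTheory.EllipticCurves.ModularForms
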